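import Summits.SmoothPoincare4.SmoothPoincare4.Theorems.ContractibleTwistedDoubleStandard.Negative.LoadBearing
import Literature.Topology.FourManifolds.HomotopyS4CompactProofs
import Literature.AlgebraicTopology.SingularHomology.ExcisionMayerVietoris

/-!
# `AcyclicBisectionRigidity` — negative-side support: shielding and load-bearing hypotheses

Support lemmas for the crux
`Summit.SmoothPoincare4.SmoothPoincare4.Theses.ConvexBisection.AcyclicBisectionRigidity`
(stmt-SmoothPoincare4-10507), from the standing disprover's work file
`Cruxes/AcyclicBisectionRigidity/Disproof.lean` §§1–3 (every variant statement inline):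

* `shielded_of_spc4` — EVERY statement of the shape `∀ M ≃ₕ S⁴, P M → M ≅ S⁴` follows from the
  summit `SmoothPoincare4`; so the crux, and the crux with ANY conjunct of its bisection hypothesis
  deleted, is SPC4-implied and cannot be refuted short of an exotic `S⁴`
  (`not_smoothPoincare4_of_not_crux`: a refutation of the crux refutes the summit);
* `not_crux_without_homotopyEquiv` — the hypothesis `M ≃ₕ S⁴` is load-bearing: deleting it makes
  the statement FALSE (Lean witness: the empty 4-manifold with its empty acyclic Stein bisection;
  honest witnesses on paper: `S⁴ ⊔ S⁴`, doubles of Stein rational balls `D(B_{p,q})`, `π₁ = ℤ/p`);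
* `smoothPoincare4_of_withoutAcyclic` — deleting ℚ-acyclicity collapses the crux onto the summit
  modulo the route's KNOWN support item `SteinBisectionExists` (stmt-10509, Baykur 2006 Thm 5.1):
  acyclicity is the only conjunct separating the crux from `SmoothPoincare4` in a costume;
* `crux_iff_compact_pathConnected` — normal form: WLOG `M` compact and path connected (PROVED tree
  facts about homotopy 4-spheres), so non-compact or disconnected `M` give the adversary nothing.
-/

noncomputable section

-- The namespace is prescribed by the crux protocol (`Summit.<P>.<Sub>.Theorems.<Crux>.Negative`
-- with `P = Sub = SmoothPoincare4`), hence the duplicated component.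
set_option linter.dupNamespace false

open scoped Manifold ContDiff Topology ContinuousMap
open Set Function Literature.Geometry.Symplectic Literature.AlgebraicTopology.SingularHomology
  CategoryTheory.Limits

namespace Summit.SmoothPoincare4.SmoothPoincare4.Theorems.AcyclicBisectionRigidity.Negative

open Summit.SmoothPoincare4.SmoothPoincare4.Theses.ConvexBisection
open Summit.SmoothPoincare4.SmoothPoincare4.Theorems.ContractibleTwistedDoubleStandard.Negative
  (isSmoothEmbedding_of_isEmpty)

/-- **Shielding.** Every statement "`∀ M ≃ₕ S⁴, P M → M ≅ S⁴`" follows from `SmoothPoincare4`,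
whatever the predicate `P` on charted 4-manifolds is. Consequence: the crux and each of its
single-conjunct deletions (Stein, contact matching, acyclicity, embedding, covering, seam
conditions) are SPC4-implied, hence refutable only by an exotic 4-sphere. [folklore] -/
theorem shielded_of_spc4
    (P : ∀ (M : Type) [TopologicalSpace M] [ChartedSpace (EuclideanSpace ℝ (Fin 4)) M], Prop)
    (h : SmoothPoincare4) :
    ∀ (M : Type) [TopologicalSpace M] [T2Space M] [SecondCountableTopology M]
      [ChartedSpace (EuclideanSpace ℝ (Fin 4)) M] [IsManifold (𝓡 4) ∞ M],
      M ≃ₕ Metric.sphere (0 : EuclideanSpace ℝ (Fin 5)) 1 → P M →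
        Nonempty (M ≃ₘ⟮𝓡 4, 𝓡 4⟯ Metric.sphere (0 : EuclideanSpace ℝ (Fin 5)) 1) :=
  fun M _ _ _ _ _ e _ => h M inferInstance inferInstance e

/-- **A refutation of the crux refutes the summit** (contrapositive of shielding at the crux's
own hypothesis): `¬ AcyclicBisectionRigidity` is literally an exotic `S⁴` carrying an acyclic
common-contact Stein bisection. [folklore] -/
theorem not_smoothPoincare4_of_not_crux (h : ¬ AcyclicBisectionRigidity) : ¬ SmoothPoincare4 :=
  fun hs => h fun M _ _ _ _ _ e _ => hs M inferInstance inferInstance e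

/-- **`M ≃ₕ S⁴` is load-bearing**: with that hypothesis deleted the crux is false. Lean witness:
the EMPTY 4-manifold bisected into two empty Stein halves (vacuous Stein structure, vacuous
embeddings, `H_k(∅; ℚ) = 0`), which is not diffeomorphic to the nonempty `S⁴`. (Degenerate; the
honest witnesses `S⁴ ⊔ S⁴` and `D(B_{p,q})` — Lekili–Maydanskiy arXiv:1202.5625 Thm 1.1, `π₁ = ℤ/p`
— are not yet constructible in the tree.) [folklore] -/
theorem not_crux_without_homotopyEquiv : ¬
    ∀ (M : Type) [TopologicalSpace M] [T2Space M] [SecondCountableTopology M]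
      [ChartedSpace (EuclideanSpace ℝ (Fin 4)) M] [IsManifold (𝓡 4) ∞ M],
      (∃ (W₁ : Type) (_ : TopologicalSpace W₁) (_ : ChartedSpace (EuclideanHalfSpace 4) W₁)
        (_ : IsManifold (𝓡∂ 4) ∞ W₁) (_ : CompactSpace W₁) (W₂ : Type) (_ : TopologicalSpace W₂)
        (_ : ChartedSpace (EuclideanHalfSpace 4) W₂) (_ : IsManifold (𝓡∂ 4) ∞ W₂) (_ : CompactSpace W₂)
        (J₁ : SteinStructure W₁) (J₂ : SteinStructure W₂) (e₁ : W₁ → M) (e₂ : W₂ → M),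
        Manifold.IsSmoothEmbedding (𝓡∂ 4) (𝓡 4) ∞ e₁ ∧ Manifold.IsSmoothEmbedding (𝓡∂ 4) (𝓡 4) ∞ e₂ ∧
        Set.range e₁ ∪ Set.range e₂ = Set.univ ∧
        Set.range e₁ ∩ Set.range e₂ = e₁ '' (𝓡∂ 4).boundary W₁ ∧
        Set.range e₁ ∩ Set.range e₂ = e₂ '' (𝓡∂ 4).boundary W₂ ∧
        (∀ w₁ w₂, e₁ w₁ = e₂ w₂ →
          Submodule.map (mfderiv (𝓡∂ 4) (𝓡 4) e₁ w₁).toLinearMap (contactPlane J₁.J w₁) =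
          Submodule.map (mfderiv (𝓡∂ 4) (𝓡 4) e₂ w₂).toLinearMap (contactPlane J₂.J w₂)) ∧
        (∀ k, 0 < k → IsZero (singularHomology ℚ ℚ W₁ k) ∧ IsZero (singularHomology ℚ ℚ W₂ k))) →
      Nonempty (M ≃ₘ⟮𝓡 4, 𝓡 4⟯ Metric.sphere (0 : EuclideanSpace ℝ (Fin 5)) 1) := by
  intro h
  letI cM : ChartedSpace (EuclideanSpace ℝ (Fin 4)) Empty := ChartedSpace.empty _ _
  letI cW : ChartedSpace (EuclideanHalfSpace 4) Empty := ChartedSpace.empty _ _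
  let S : SteinStructure Empty :=
    { J := fun x => isEmptyElim x
      φ := fun x => isEmptyElim x
      J_sq := fun x => isEmptyElim x
      J_smooth := fun _ _ => fun x => isEmptyElim x
      integrable := fun _ _ _ _ x => isEmptyElim x
      φ_smooth := fun x => isEmptyElim x
      convex := fun x => isEmptyElim x
      boundary_eq := fun x => isEmptyElim x
      regular := fun x => isEmptyElim x }
  obtain ⟨Φ⟩ := h Empty ⟨Empty, inferInstance, inferInstance, inferInstance, inferInstance,
    Empty, inferInstance, inferInstance, inferInstance, inferInstance, S, S, Empty.elim, Empty.elim,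
    isSmoothEmbedding_of_isEmpty _, isSmoothEmbedding_of_isEmpty _,
    Subsingleton.elim _ _, Subsingleton.elim _ _, Subsingleton.elim _ _, fun w => w.elim,
    fun k hk => ⟨isZero_singularHomology_of_subsingleton ℚ ℚ hk.ne',
      isZero_singularHomology_of_subsingleton ℚ ℚ hk.ne'⟩⟩
  exact isEmptyElim (Φ.symm ⟨EuclideanSpace.single 0 1, by simp⟩)

/-- **Deleting ℚ-acyclicity collapses the crux onto the summit**, modulo the route's KNOWN
support item `SteinBisectionExists` (every homotopy 4-sphere has a common-contact Stein
bisection: Baykur arXiv:math/0601396 Thm 5.1 / Breen arXiv:2311.16058 Thm 1.6): the mutation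
"crux without acyclic" together with `SteinBisectionExists` gives `SmoothPoincare4` outright. So
acyclicity is the only conjunct that separates the crux from the summit. [folklore] -/
theorem smoothPoincare4_of_withoutAcyclic
    (h : ∀ (M : Type) [TopologicalSpace M] [T2Space M] [SecondCountableTopology M]
      [ChartedSpace (EuclideanSpace ℝ (Fin 4)) M] [IsManifold (𝓡 4) ∞ M],
      M ≃ₕ Metric.sphere (0 : EuclideanSpace ℝ (Fin 5)) 1 →
      (∃ (W₁ : Type) (_ : TopologicalSpace W₁) (_ : ChartedSpace (EuclideanHalfSpace 4) W₁)
        (_ : IsManifold (𝓡∂ 4) ∞ W₁) (_ : CompactSpace W₁) (W₂ : Type) (_ : TopologicalSpace W₂)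
        (_ : ChartedSpace (EuclideanHalfSpace 4) W₂) (_ : IsManifold (𝓡∂ 4) ∞ W₂) (_ : CompactSpace W₂)
        (J₁ : SteinStructure W₁) (J₂ : SteinStructure W₂) (e₁ : W₁ → M) (e₂ : W₂ → M),
        Manifold.IsSmoothEmbedding (𝓡∂ 4) (𝓡 4) ∞ e₁ ∧ Manifold.IsSmoothEmbedding (𝓡∂ 4) (𝓡 4) ∞ e₂ ∧
        Set.range e₁ ∪ Set.range e₂ = Set.univ ∧
        Set.range e₁ ∩ Set.range e₂ = e₁ '' (𝓡∂ 4).boundary W₁ ∧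
        Set.range e₁ ∩ Set.range e₂ = e₂ '' (𝓡∂ 4).boundary W₂ ∧
        (∀ w₁ w₂, e₁ w₁ = e₂ w₂ →
          Submodule.map (mfderiv (𝓡∂ 4) (𝓡 4) e₁ w₁).toLinearMap (contactPlane J₁.J w₁) =
          Submodule.map (mfderiv (𝓡∂ 4) (𝓡 4) e₂ w₂).toLinearMap (contactPlane J₂.J w₂))) →
      Nonempty (M ≃ₘ⟮𝓡 4, 𝓡 4⟯ Metric.sphere (0 : EuclideanSpace ℝ (Fin 5)) 1))
    (hB : SteinBisectionExists) : SmoothPoincare4 :=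
  fun M _ _ _ _ _ e => h M e (hB M e)

/-- **Normal form: WLOG `M` is compact and path connected.** Both follow from `M ≃ₕ S⁴` by PROVED
tree facts (`compactSpace_of_homotopyEquiv_sphere_four_holds`, `pathConnectedSpace_of_homotopyEquiv`
with `pathConnectedSpace_sphere_four`), so the crux is equivalent to its restriction to compact
path-connected (in particular nonempty, connected) `M`. [folklore] -/
theorem crux_iff_compact_pathConnected : AcyclicBisectionRigidity ↔
    ∀ (M : Type) [TopologicalSpace M] [T2Space M] [SecondCountableTopology M]
      [ChartedSpace (EuclideanSpace ℝ (Fin 4)) M] [IsManifold (𝓡 4) ∞ M]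
      [CompactSpace M] [PathConnectedSpace M],
      M ≃ₕ Metric.sphere (0 : EuclideanSpace ℝ (Fin 5)) 1 →
      (∃ (W₁ : Type) (_ : TopologicalSpace W₁) (_ : ChartedSpace (EuclideanHalfSpace 4) W₁)
        (_ : IsManifold (𝓡∂ 4) ∞ W₁) (_ : CompactSpace W₁) (W₂ : Type) (_ : TopologicalSpace W₂)
        (_ : ChartedSpace (EuclideanHalfSpace 4) W₂) (_ : IsManifold (𝓡∂ 4) ∞ W₂) (_ : CompactSpace W₂)
        (J₁ : SteinStructure W₁) (J₂ : SteinStructure W₂) (e₁ : W₁ → M) (e₂ : W₂ → M),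
        Manifold.IsSmoothEmbedding (𝓡∂ 4) (𝓡 4) ∞ e₁ ∧ Manifold.IsSmoothEmbedding (𝓡∂ 4) (𝓡 4) ∞ e₂ ∧
        Set.range e₁ ∪ Set.range e₂ = Set.univ ∧
        Set.range e₁ ∩ Set.range e₂ = e₁ '' (𝓡∂ 4).boundary W₁ ∧
        Set.range e₁ ∩ Set.range e₂ = e₂ '' (𝓡∂ 4).boundary W₂ ∧
        (∀ w₁ w₂, e₁ w₁ = e₂ w₂ →
          Submodule.map (mfderiv (𝓡∂ 4) (𝓡 4) e₁ w₁).toLinearMap (contactPlane J₁.J w₁) =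
          Submodule.map (mfderiv (𝓡∂ 4) (𝓡 4) e₂ w₂).toLinearMap (contactPlane J₂.J w₂)) ∧
        (∀ k, 0 < k → IsZero (singularHomology ℚ ℚ W₁ k) ∧ IsZero (singularHomology ℚ ℚ W₂ k))) →
      Nonempty (M ≃ₘ⟮𝓡 4, 𝓡 4⟯ Metric.sphere (0 : EuclideanSpace ℝ (Fin 5)) 1) := by
  refine ⟨fun h M _ _ _ _ _ _ _ e hb => h M e hb, fun h M _ _ _ _ _ e hb => ?_⟩
  haveI : CompactSpace M :=
    Literature.Topology.FourManifolds.compactSpace_of_homotopyEquiv_sphere_four_holds M e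
  haveI := Literature.Topology.FourManifolds.pathConnectedSpace_sphere_four
  haveI : PathConnectedSpace M :=
    Literature.Topology.FourManifolds.pathConnectedSpace_of_homotopyEquiv e
  exact h M e hb

end Summit.SmoothPoincare4.SmoothPoincare4.Theorems.AcyclicBisectionRigidity.Negative
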